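import Mathlib
import Summits.KontsevichZagierPeriods.Zeta5Search.Elimination.DictBridge
import Summits.KontsevichZagierPeriods.Zeta5Search.Elimination.HalfShiftBridgeFormal
import Summits.KontsevichZagierPeriods.Zeta5Search.WedgeDictionaryDictStarWide
import HarnessLib

/-!
# gen-1's dictionary BRIDGE relation at WIDE-region clusters, including the vanishing strata (cell `pub-zeta5`, seat ct-1 g23)

HONEST FRAMING: systematic search; no irrationality claim unless certified — identities among the cell's rational dictionary data
(`QOf` = Brown–Zudilin's (17), `dictPhat`, `dictP`; the closed forms `U, W, V`; the gauge `ρ`) on the cell's own WIDE parameter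
region; no cellular integral is evaluated, nothing about `ζ(5)`; no `def`, no new node.

fam-elim g24's `Elimination.dictBridge_at` proves gen-1's four-term node `DictBridge`
`bridgeBase(c)·v(a) + bridgeSlot(c)·v(a − s₇) + bridgeHalf(c)·v(a + e₁ + e₃) + bridgeApex(c)·v(a + DS) = 0` (`v = (Q, P̂_d, P_d)`,
`c = b(a)`) on the INTERIOR of the half box: `RegionHyp` at the four points, `c₀ ≥ 2`, all six non-edge pair sums `≤ c₀` — the last
because its ρ-free input `halfShiftBridge` needs `cas3(c) ≠ 0`.  With ct-1 g23's rank-free `halfShiftBridge_box`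
(`Elimination/HalfShiftBridgeFormal`), ct-1 g22's wide dictionary values `dict_values_wide` and fam-elim's box-wide gauge ratios
`rhoB_dsShift / rhoB_hShift / rhoB_bump6`, the SAME assembly (`bridge_assemble`) gives the relation at every cluster whose four members
lie in the WIDE region (convergent, `b ≥ 0`, `d ≥ 0`) with the single non-edge condition `c₁ + c₆ ≤ c₀` (the pair entering `pr`):

* **`dictBridge_wide`** — `DictFourTerm (bridgeBase c) (bridgeSlot c) (bridgeHalf c) (bridgeApex c) a (a − s₇) (a + e₁ + e₃) (a + DS)
  j₀ j₁ j₂ j₃` for all partners `j_m ∈ [1,7]`.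

In particular it holds at the TWO-MAX clusters `c = (N; M, …, M−1)`, `2M ≥ N+2` (the pair `{1,7}` exceeds the level, `U ≡ 0` at all
four members), where the induction for the off-half-box residual of `wedgeDictionaryFull` (ct-1 g23, INBOX l.9031; blueprint
`HOME/ct-1/g22/WIDE-RESIDUAL.md`) resolves the shapes `(M)`, `(M,m)`, `(M,m,m)`, `(M,M)` by the BRIDGE with the maximal slot raised;
checked exactly beforehand at 620/620 such clusters of levels `≤ 7` (`code/twomax_bridge.py`).
-/

open Finset

namespace Summit.KontsevichZagierPeriods.Zeta5Search.Elimination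

open Summit.KontsevichZagierPeriods.Zeta5Search.DualSeries (InBox)
open Summit.KontsevichZagierPeriods.Zeta5Search.WedgeDictionary
open Summit.KontsevichZagierPeriods.Zeta5Search.SymmetricGauge
open Summit.KontsevichZagierPeriods.Zeta5Search.WedgeDictionaryDictStarWide (dict_values_wide)
open Literature.NumberTheory.Irrationality.BrownZudilin2022 (bOfA Converges QOf)

set_option maxHeartbeats 800000 in
/-- **gen-1's dictionary BRIDGE at every wide cluster.**  If the four points `a`, `a − s₇`, `a + e₁ + e₃`, `a + DS` are convergent
with non-negative dual slots and `d ≥ 0`, and `c₁ + c₆ ≤ c₀` at `c = b(a)`, then for all partners `j₀, j₁, j₂, j₃ ∈ [1,7]`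
`bridgeBase(c)·v(a) + bridgeSlot(c)·v(a − s₇) + bridgeHalf(c)·v(a + e₁ + e₃) + bridgeApex(c)·v(a + DS) = 0` for the three dictionary
coordinates — fam-elim's `dictBridge_at` assembly on top of the rank-free `halfShiftBridge_box`. [folklore] -/
theorem dictBridge_wide (a : Fin 8 → ℤ) (j₀ j₁ j₂ j₃ : ℕ) (hj₀ : j₀ ∈ Icc 1 7) (hj₁ : j₁ ∈ Icc 1 7) (hj₂ : j₂ ∈ Icc 1 7)
    (hj₃ : j₃ ∈ Icc 1 7)
    (hc₀ : Converges a) (hn₀ : ∀ m ∈ Icc 1 7, 0 ≤ bOfA a m) (hd₀ : 0 ≤ dOf (bOfA a))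
    (hc₁ : Converges (a - slotDown 7)) (hn₁ : ∀ m ∈ Icc 1 7, 0 ≤ bOfA (a - slotDown 7) m) (hd₁ : 0 ≤ dOf (bOfA (a - slotDown 7)))
    (hc₂ : Converges (a + halfUp457)) (hn₂ : ∀ m ∈ Icc 1 7, 0 ≤ bOfA (a + halfUp457) m) (hd₂ : 0 ≤ dOf (bOfA (a + halfUp457)))
    (hc₃ : Converges (a + dsUp)) (hn₃ : ∀ m ∈ Icc 1 7, 0 ≤ bOfA (a + dsUp) m) (hd₃ : 0 ≤ dOf (bOfA (a + dsUp)))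
    (h16 : bOfA a 1 + bOfA a 6 ≤ bOfA a 0) :
    DictFourTerm (bridgeBase (bOfA a)) (bridgeSlot (bOfA a)) (bridgeHalf (bOfA a)) (bridgeApex (bOfA a))
      a (a - slotDown 7) (a + halfUp457) (a + dsUp) j₀ j₁ j₂ j₃ := by
  -- the dictionary values at the four points
  obtain ⟨hQ0, hPh0, hP0⟩ := dict_values_wide hj₀ hc₀ hn₀ hd₀
  obtain ⟨hQ1, hPh1, hP1⟩ := dict_values_wide hj₁ hc₁ hn₁ hd₁
  obtain ⟨hQ2, hPh2, hP2⟩ := dict_values_wide hj₂ hc₂ hn₂ hd₂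
  obtain ⟨hQ3, hPh3, hP3⟩ := dict_values_wide hj₃ hc₃ hn₃ hd₃
  obtain ⟨hcI, hle⟩ := inBox_of_full a hc₀ hn₀
  have hle1 := bOfA_le_of_nonneg (a - slotDown 7) hc₁ hn₁
  set c := bOfA a with hc
  -- the dual coordinates of the three other points: `c + e₇`, `Hc`, `DSc`
  have h7b : ∀ j, j ≤ 7 → bOfA (a - slotDown 7) j = bump c 6 j := fun j hj => by
    rw [bOfA_sub_slotDown7 a j hj]
    by_cases h : j = 7
    · rw [if_pos h, h, bump6_seven]
    · rw [if_neg h, bump_of_ne c (show j ≠ 6 + 1 by omega)]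
  have hHb : ∀ j, j ≤ 7 → bOfA (a + halfUp457) j = hShift c j := fun j hj => by
    rw [bOfA_add_halfUp457 a j hj]
    unfold hShift
    rfl
  have hDb : ∀ j, j ≤ 7 → bOfA (a + dsUp) j = dsShift c j := fun j hj => by
    rw [bOfA_add_dsUp a j hj, dsShift_apply]
  -- facts at `c`
  have hE : ∀ jk ∈ Epairs, c jk.1 + c jk.2 ≤ c 0 := epairs_le_of_converges a hc₀
  have h7 : c 7 + 1 ≤ c 0 := by
    have h := hle1 7 (by simp)
    rw [h7b 7 (by norm_num), h7b 0 (by norm_num), bump6_seven, bump_zero] at h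
    omega
  have hc7 : 0 ≤ c 7 := hn₀ 7 (by simp)
  have hd : 1 ≤ dOf c := by rw [dOf_congr hDb, dOf_dsShift] at hd₃; omega
  -- the two strict `T`-pair inequalities (edge pairs `47`, `57` at `Hc`) and the edge pairs at `c + e₇`
  obtain ⟨v0, -, -, -, v4, v5, -, v7⟩ := hShift_vals c
  have h47 : c 4 + c 7 + 1 ≤ c 0 := by
    have h := epairs_le_of_converges _ hc₂ (4, 7) (by decide)
    simp only at h
    rw [hHb 4 (by norm_num), hHb 7 (by norm_num), hHb 0 (by norm_num), v0, v4, v7] at h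
    omega
  have h57 : c 5 + c 7 + 1 ≤ c 0 := by
    have h := epairs_le_of_converges _ hc₂ (5, 7) (by decide)
    simp only at h
    rw [hHb 5 (by norm_num), hHb 7 (by norm_num), hHb 0 (by norm_num), v0, v5, v7] at h
    omega
  have hE7 : ∀ jk ∈ Epairs, bump c 6 jk.1 + bump c 6 jk.2 ≤ c 0 := fun jk hjk => by
    obtain ⟨-, h17, -, h27, -⟩ := epairs_bounds jk hjk
    have h := epairs_le_of_converges _ hc₁ jk hjk
    rw [h7b jk.1 h17, h7b jk.2 h27, h7b 0 (by norm_num), bump_zero] at h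
    exact h
  have h12 := hE (1, 2) (by decide); have h13 := hE (1, 3) (by decide); have h23 := hE (2, 3) (by decide)
  have h26 := hE (2, 6) (by decide); have h36 := hE (3, 6) (by decide)
  simp only at h12 h13 h23 h26 h36
  -- (1) the ρ-free bridge WITHOUT the rank condition, with `d` as `dOf` and `A` factored
  obtain ⟨TUW, TUV, TVW⟩ := halfShiftBridge_box c hcI hd h7 h12 h13 h16 h23 h26 h36
  rw [raiseD_eq, meetA_factor] at TUW TUV TVW
  -- (2) the three gauge ratios
  have R1 := rhoB_dsShift c hcI hd
  have R2 := rhoB_hShift c hcI h47 h57 h12 h13 h23 h26 h36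
  have R3 := rhoB_bump6 c hcI h7 hd hE7
  -- (3) the five coefficient identities (`F = ∏_{j∈{1,4,5,6,7}}(c_j+1)`)
  have hpi : ((c 4 : ℚ) + 1) * ((c 5 : ℚ) + 1) * ((c 7 : ℚ) + 1) = raisePiT c := rfl
  rw [hpi] at R2
  have hδ : (bridgeApex c : ℚ) * raisePiT c = ((([1, 4, 5, 6, 7] : List ℕ).map fun j => ((c j : ℚ) + 1)).prod) := by
    simp only [List.map_cons, List.map_nil, List.prod_cons, List.prod_nil, bridgeApex, raisePiT]
    push_cast
    ring
  have hα : (bridgeBase c : ℚ) * raisePiT c = dsLam c 6 * bridgeB0 c := by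
    simp only [bridgeBase, raisePiT, bridgeB0, dsLam_six]
    push_cast
    ring
  have hβ : (bridgeSlot c : ℚ) = -(((c 0 : ℚ) - c 3 - c 7) * ((c 0 : ℚ) - c 6 - c 7)) := by
    simp only [bridgeSlot]
    push_cast
    ring
  have hγ : (bridgeHalf c : ℚ) * ((c 7 : ℚ) + 1) = dsLam c 6 * ((c 0 : ℚ) + 1 - c 1 - c 6) := by
    simp only [bridgeHalf, dsLam_six]
    push_cast
    ring
  have hpr : raisePr c = ((c 0 : ℚ) + 1 - c 1 - c 2) * ((c 0 : ℚ) + 1 - c 1 - c 3) * ((c 0 : ℚ) + 1 - c 2 - c 3) *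
      ((c 0 : ℚ) + 1 - c 2 - c 6) * ((c 0 : ℚ) + 1 - c 3 - c 6) * ((c 0 : ℚ) + 1 - c 1 - c 6) := by
    unfold raisePr
    ac_rfl
  -- non-vanishing of the cancelled product
  have p1 := hn₀ 1 (by simp); have p4 := hn₀ 4 (by simp); have p5 := hn₀ 5 (by simp); have p6 := hn₀ 6 (by simp)
  have q1 : (0 : ℚ) < c 1 + 1 := by have := (show (0 : ℚ) ≤ c 1 by exact_mod_cast p1); linarith
  have q4 : (0 : ℚ) < c 4 + 1 := by have := (show (0 : ℚ) ≤ c 4 by exact_mod_cast p4); linarith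
  have q5 : (0 : ℚ) < c 5 + 1 := by have := (show (0 : ℚ) ≤ c 5 by exact_mod_cast p5); linarith
  have q6 : (0 : ℚ) < c 6 + 1 := by have := (show (0 : ℚ) ≤ c 6 by exact_mod_cast p6); linarith
  have q7 : (0 : ℚ) < c 7 + 1 := by have := (show (0 : ℚ) ≤ c 7 by exact_mod_cast hc7); linarith
  have hF : ((([1, 4, 5, 6, 7] : List ℕ).map fun j => ((c j : ℚ) + 1)).prod) ≠ 0 := by
    simp only [List.map_cons, List.map_nil, List.prod_cons, List.prod_nil, mul_one]
    positivity
  have hs7 : (c 7 : ℚ) + 1 ≠ 0 := q7.ne'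
  have hm4 : (c 0 : ℚ) - c 4 - c 7 ≠ 0 := by
    have : (1 : ℚ) ≤ (c 0 : ℚ) - c 4 - c 7 := by exact_mod_cast (show 1 ≤ c 0 - c 4 - c 7 by omega)
    exact ne_of_gt (by linarith)
  have hm5 : (c 0 : ℚ) - c 5 - c 7 ≠ 0 := by
    have : (1 : ℚ) ≤ (c 0 : ℚ) - c 5 - c 7 := by exact_mod_cast (show 1 ≤ c 0 - c 5 - c 7 by omega)
    exact ne_of_gt (by linarith)
  have hdq : (dOf c : ℚ) ≠ 0 := by
    have : (1 : ℚ) ≤ dOf c := by exact_mod_cast hd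
    exact ne_of_gt (by linarith)
  have hpiT : raisePiT c ≠ 0 := by unfold raisePiT; positivity
  -- rewrite the twelve dictionary values
  rw [rhoOf_eq_rhoB, ← hc] at hQ0 hPh0 hP0
  rw [rhoOf_eq_rhoB] at hQ1 hPh1 hP1 hQ2 hPh2 hP2 hQ3 hPh3 hP3
  rw [rhoB_congr h7b, (cas_congr h7b).1] at hQ1
  rw [rhoB_congr h7b, (cas_congr h7b).2.1] at hPh1
  rw [rhoB_congr h7b, (cas_congr h7b).2.2] at hP1
  rw [rhoB_congr hHb, (cas_congr hHb).1] at hQ2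
  rw [rhoB_congr hHb, (cas_congr hHb).2.1] at hPh2
  rw [rhoB_congr hHb, (cas_congr hHb).2.2] at hP2
  rw [rhoB_congr hDb, (cas_congr hDb).1] at hQ3
  rw [rhoB_congr hDb, (cas_congr hDb).2.1] at hPh3
  rw [rhoB_congr hDb, (cas_congr hDb).2.2] at hP3
  unfold DictFourTerm
  rw [hQ0, hPh0, hP0, hQ1, hPh1, hP1, hQ2, hPh2, hP2, hQ3, hPh3, hP3]
  exact ⟨bridge_assemble TUW R1 R2 R3 hδ hα hβ hγ hpr hF hs7 hm4 hm5 hdq hpiT,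
    bridge_assemble TUV R1 R2 R3 hδ hα hβ hγ hpr hF hs7 hm4 hm5 hdq hpiT,
    bridge_assemble TVW R1 R2 R3 hδ hα hβ hγ hpr hF hs7 hm4 hm5 hdq hpiT⟩

end Summit.KontsevichZagierPeriods.Zeta5Search.Elimination
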